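import Summits.CriticalPhenomena.PercolationContinuityZ3.Theorems.PercNonProliferationSubpolynomialBlockingStubSixSlab
import Literature.Probability.Percolation.SiteConnectionTools
import Literature.Probability.Percolation.HalfSpaceBrickSymmetry
import HarnessLib

/-!
# Crux `PercNonProliferation.SubpolynomialBlocking` (stmt-CriticalPhenomena-4446), line `root-trick-wall-patch` — stub `stub_harrisShields`

Helper file for the crux skeleton `Cruxes/SubpolynomialBlocking/Lines/root_trick_wall_patch.lean`
(lead prover-line-stmt-CriticalPhenomena-4446-1). Proves exactly the registered stub signature
`stub_harrisShields`; lands with `--supports stmt-CriticalPhenomena-4446`.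

## The statement (Harris step `h r ^ 100 ≤ P(⋂_c shield_c)`)

At `p = p_c(ℤ³)` let `h r = P((openCrossing (hsBall r) (patch r) (farFace r))ᶜ)` be the critical
wall-patch enclosure probability, where `patch r = {0} × [0, r)²`,
`hsBall r = [0, 4r] × [-4r, 5r-1]²` (the order interval
`Set.Icc ![0, -4r, -4r] ![4r, 5r-1, 5r-1]` of `Site 3 = Fin 3 → ℤ`) and `farFace r` is the set of
points of `hsBall r` with `x₀ = 4r` or a lateral coordinate at an extreme value. The `100` cell
shield events are the enclosure event transported by the lattice translations
`τ_c = zdShiftIso (0, c₁ r, c₂ r)`, `c : Fin 10 × Fin 10`: no open path inside `τ_c '' hsBall r` from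
`τ_c '' patch r` to `τ_c '' farFace r`. Then `h r ^ 100 ≤ P(⋂_c shield_c)`.

## The argument

* SYMMETRY. Each shield event is literally `(openCrossing (τ '' S) (τ '' A) (τ '' B))ᶜ` for the graph
  automorphism `τ = zdShiftIso v_c` of `ℤ³`, so its probability equals
  `P((openCrossing S A B)ᶜ) = h r` (`StubSixSlab.real_compl_openCrossing_image`; Grimmett 1999 §1.6,
  invariance of `P_p` under lattice automorphisms).
* MONOTONICITY / MEASURABILITY. Each shield event is decreasing (`isUpperSet_openCrossing`,
  complemented) and measurable (`measurableSet_openCrossing_of_countable`, complemented).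
* HARRIS–FKG for finitely many decreasing events of equal probability
  (`prob_pow_le_biInter_of_isLowerSet`, Grimmett 1999 Thm. 2.4) over the index set
  `Fin 10 × Fin 10` of cardinality `100`: `h r ^ 100 ≤ P(⋂_{c ∈ univ} shield_c) = P(⋂_c shield_c)`.

No new definitions; the events are written as images of the three sets of the signature.
-/

noncomputable section

namespace Summit.CriticalPhenomena.PercolationContinuityZ3.Theorems.SubpolynomialBlocking

open MeasureTheory Filter Topology
open Literature.Probability.Percolation Literature.Probability.LatticeModels

namespace StubHarrisShields

/-- **Assembly of the measure-theoretic step.** `100` decreasing measurable events of common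
probability `v`, indexed by `Fin 10 × Fin 10`, satisfy `v ^ 100 ≤ P(⋂_c E c)`
(Harris–FKG for finitely many decreasing events, `prob_pow_le_biInter_of_isLowerSet` over
`Finset.univ`, whose cardinality is `10 * 10 = 100`; the bounded intersection over `univ` is the
plain intersection). -/
theorem pow_hundred_le (p : unitInterval) {E : Fin 10 × Fin 10 → Set (BondConfig (Site 3))} {v : ℝ}
    (hE : ∀ q, (bondPercolation (zdGraph 3) p).real (E q) = v) (hL : ∀ q, IsLowerSet (E q))
    (hM : ∀ q, MeasurableSet (E q)) :
    v ^ 100 ≤ (bondPercolation (zdGraph 3) p).real (⋂ q, E q) := by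
  have h1 := prob_pow_le_biInter_of_isLowerSet (zdGraph 3) p Finset.univ E (fun q _ => hL q)
    (fun q _ => hM q) (fun q _ => hE q)
  have h2 : (Finset.univ : Finset (Fin 10 × Fin 10)).card = 100 := by
    rw [Finset.card_univ, Fintype.card_prod, Fintype.card_fin]
  rw [h2] at h1
  simpa only [Finset.mem_univ, Set.iInter_true] using h1

end StubHarrisShields

/-- **Registered stub `stub_harrisShields`** (line `root-trick-wall-patch`, crux
`SubpolynomialBlocking`): the HARRIS STEP `h r ^ 100 ≤ P_{p_c}(⋂_c shield_c)`, where
`h r = P_{p_c}((openCrossing (hsBall r) (patch r) (farFace r))ᶜ)` is the critical wall-patch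
enclosure probability (`patch r = {0} × [0,r)²`, `hsBall r = [0,4r] × [-4r,5r-1]²`, `farFace r` the
points of `hsBall r` at depth `4r` or extreme lateral coordinate) and `shield_c`
(`c : Fin 10 × Fin 10`) is the same event transported by the translation
`zdShiftIso (0, c₁ r, c₂ r)`. Proof: each shield has probability `h r` (invariance of `P_p` under
lattice automorphisms, `StubSixSlab.real_compl_openCrossing_image`), is decreasing and measurable,
and Harris–FKG over the `100` cells gives `h r ^ 100 ≤ P(⋂)`. (Grimmett 1999, Thm. 2.4 and §1.6.) -/
theorem stub_harrisShields :
    ∀ r : ℕ,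
      (bondPercolation (zdGraph 3) (criticalProbI 3)).real
          (openCrossing
            (Set.Icc (![0, -(4 * (r : ℤ)), -(4 * (r : ℤ))] : Site 3) ![4 * (r : ℤ), 5 * (r : ℤ) - 1, 5 * (r : ℤ) - 1])
            {x : Site 3 | x 0 = 0 ∧ 0 ≤ x 1 ∧ x 1 < (r : ℤ) ∧ 0 ≤ x 2 ∧ x 2 < (r : ℤ)}
            {y : Site 3 | y ∈ Set.Icc (![0, -(4 * (r : ℤ)), -(4 * (r : ℤ))] : Site 3)
                ![4 * (r : ℤ), 5 * (r : ℤ) - 1, 5 * (r : ℤ) - 1] ∧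
              (y 0 = 4 * (r : ℤ) ∨ y 1 = -(4 * (r : ℤ)) ∨ y 1 = 5 * (r : ℤ) - 1 ∨
                y 2 = -(4 * (r : ℤ)) ∨ y 2 = 5 * (r : ℤ) - 1)})ᶜ ^ 100 ≤
        (bondPercolation (zdGraph 3) (criticalProbI 3)).real
          (⋂ c : Fin 10 × Fin 10, (openCrossing
            ((zdShiftIso (![0, ((c.1 : ℕ) : ℤ) * (r : ℤ), ((c.2 : ℕ) : ℤ) * (r : ℤ)] : Site 3)) ''
              Set.Icc (![0, -(4 * (r : ℤ)), -(4 * (r : ℤ))] : Site 3) ![4 * (r : ℤ), 5 * (r : ℤ) - 1, 5 * (r : ℤ) - 1])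
            ((zdShiftIso (![0, ((c.1 : ℕ) : ℤ) * (r : ℤ), ((c.2 : ℕ) : ℤ) * (r : ℤ)] : Site 3)) ''
              {x : Site 3 | x 0 = 0 ∧ 0 ≤ x 1 ∧ x 1 < (r : ℤ) ∧ 0 ≤ x 2 ∧ x 2 < (r : ℤ)})
            ((zdShiftIso (![0, ((c.1 : ℕ) : ℤ) * (r : ℤ), ((c.2 : ℕ) : ℤ) * (r : ℤ)] : Site 3)) ''
              {y : Site 3 | y ∈ Set.Icc (![0, -(4 * (r : ℤ)), -(4 * (r : ℤ))] : Site 3)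
                  ![4 * (r : ℤ), 5 * (r : ℤ) - 1, 5 * (r : ℤ) - 1] ∧
                (y 0 = 4 * (r : ℤ) ∨ y 1 = -(4 * (r : ℤ)) ∨ y 1 = 5 * (r : ℤ) - 1 ∨
                  y 2 = -(4 * (r : ℤ)) ∨ y 2 = 5 * (r : ℤ) - 1)}))ᶜ) := by
  intro r
  exact StubHarrisShields.pow_hundred_le (criticalProbI 3)
    (fun c => StubSixSlab.real_compl_openCrossing_image _ _ _ _ _)
    (fun c => (isUpperSet_openCrossing _ _ _).compl)
    (fun c => (measurableSet_openCrossing_of_countable _ _ _).compl)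

end Summit.CriticalPhenomena.PercolationContinuityZ3.Theorems.SubpolynomialBlocking

end
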